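import Literature.AnabelianGeometry.SemiGraphs.ArithThm54CharCoresCapstoneV7
import Literature.AnabelianGeometry.SemiGraphs.ArithNotAmpleBot
import Literature.AnabelianGeometry.SemiGraphs.ArithChartRepresentativesOfPresentation
import HarnessLib

/-!
# [SemiAnbd] Thm 5.4 (i) ∧ (ii) AT `π₁^temp(𝒢) ⋊^out Π_A` OF THE CHARACTERISTIC GALOIS TOWER — CAPSTONE v8:
# the vertex transport `hV` DERIVED from the branch transport `hBR`; `hbot` DERIVED from `[Infinite Π_A]`;
# the pin `Rc`/`hRcV`/`hRcB` a TERM (`hest` read at print's own decomposition data)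

Mochizuki, *Semi-graphs of anabelioids*, Publ. RIMS **42** (2006) 221–322, §5 Thm 5.4 (i)(ii), manuscript p. 66
(l. 50: "the proofs are entirely parallel to those of Theorem 3.7, Corollary 3.9"); Def 5.3 (i) p. 65; Def 5.1 (i)
p. 62; Prop 3.6 (iv) p. 39; Thm 3.7 (i) p. 40; §1 p. 11 (semi-graphs, branches, the associated topological space)
[cite: MochizukiSemiAnbd2006, Thm 5.4 (i), p. 66].

PROOF-ONLY file (abc-iut cell, layer L3, producer row T54-B = `plan/GAP-LEDGER.md` G-w4d053-1; seat
abc-iut-w4-d029 gen 6, self-named sequel «T54·CAPSTONE-v8 (hV derived)» of this seat's v7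
`ArithThm54CharCoresCapstoneV7.lean` p447144).  No definition, no new named fact, no producer restated — every input is
consumed BY NAME.  What is new relative to v7:

* `SemiGraph.exists_abuts_eq_some_of_isConnected` — in a CONNECTED semi-graph with at least one edge every vertex
  carries a branch (§1 p. 11: the first step of a walk in the barycentric subdivision from the vertex `v` towards the
  midpoint of an edge is a branch–vertex incidence at `v`).
* `hV_of_hBR` / `hV_of_hBR_of_isConnected` — at ANY chart `c` of `π₁^temp(𝒢)` and any outer action `ρ′ : Π_A → Out`,
  the vertex-transport binder `hV` of the T54 assemblies (Prop 3.6 (iv) at `ρ_𝔾(a)` for VERTICIAL subgroups) at a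
  vertex carrying a branch FOLLOWS from the branch-transport binder `hBR`: a verticial subgroup at `v` is the range of
  a verticial homomorphism `ψ` (definition of `verticialSubgroups`, Thm 3.7 (i)); `hBR` at a branch `b` abutting to
  `v` provides a representative `Φ` of `ρ′ a` and a verticial `φ′` at `a·v` with `Φ(range ψ) = x′·(range φ′)·x′⁻¹`, and
  conjugates of verticial subgroups are verticial (`conj_mem_verticialSubgroups`, Prop 3.2).  (v6 already derived the
  EDGE transport `hE` from `hBR`; so for a connected `𝒢` with an edge the whole Prop 3.6 (iv) transport datum of the
  outer model is `hBR` alone.)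
* `hbot` (`⊥` not arithmetically ample, Def 5.3 (i)) is abc-iut-w4-d098's `not_isArithAmple_bot_of_compactSpace` under
  `[Infinite Π_A]` (print: `Π_A = π̂₁(A)` an infinite profinite group).
* the pin binders `Rc`/`hRcV`/`hRcB` of v4–v7 LEAVE THE STATEMENT (abc-iut-w4-d059's recipe 13:32Z): the §3
  representatives at which the (AI4″) producer runs and at which Thm 5.4's own hypothesis `hest` (Def 5.3 (ii)) is
  read are the TERM `ChartRepresentatives.ofPresentation` (abc-iut-w4-d059 p448734) read off abc-iut-L3-d4's
  presentation of `π₁^temp(𝒢)` — `H_v`, `s_b·M_{e(b)}·s_b⁻¹`, print's own decomposition groups of the reference lifts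
  (p. 65) — with `hRcV`/`hRcB := fun _ => rfl`; `GaloisLevelData.piPresentation_H_mem_verticialSubgroups_chart` is the
  `hPH` input of that term (abc-iut-L3-t9's `range_decompHom_mem_verticialSubgroups_chart` under `piPresentation_H`).
  The CONCLUSION stays at an ARBITRARY `Rc'` (abc-iut-w4-d059's `…_iff_chart` transfer inside v7).

* `arithMaximalCompactStatement_outerAction_piPresentation_chart_of_branchTransport` — v7's chart-level theorem
  with `hV := hV_of_hBR_of_isConnected … hBR`, `hbot := not_isArithAmple_bot_of_compactSpace _`,
  `Rc := ChartRepresentatives.ofPresentation …`, `hRcV`/`hRcB := fun _ => rfl`;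
* `arithMaximalCompactStatement_outerAction_piPresentation_charCores_of_branchTransport` — **CAPSTONE v8** at
  abc-iut-w4-d048's characteristic tower `GaloisLevelData.ofCharCores h36 v₀ hVt hEt`.

HONEST RESIDUAL of CAPSTONE v8 (explicit binders; owners): DESIGN data = branch transport `hBR` (Prop 3.6 (iv) at
`ρ_𝔾(a)` / Def 5.1 (i); abc-iut-w4-d082's currency) and `n₁`/`hCC` (Def 5.1 (i)(c)/(d) + Prop 5.2 (i):
congruence-continuity of the outer action at the deep tree levels with trivial base action near `1` — DESIGN,
abc-iut-w6-d117's label); the topology pin `hinst` (`rfl` at consumers); Thm 5.4's printed frame `noSwitchBase`; Thm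
5.4's OWN hypothesis `hest` (total arithmetic estrangement of print's decomposition data `decompositionDataOfChart
(ofPresentation …)`; FALSE at split actions — abc-iut-w6-d072 p433406; inhabited non-split at an abstract tower —
abc-iut-w4-d089 p440884); the arbitrary representatives `Rc'` of the conclusion; the §5 frame `[CompactSpace Π_A] [TotallyDisconnectedSpace Π_A] [Infinite Π_A]`; Def 5.1 (i)
coherence `[Finite Vertex] [Finite Branch] [Finite Edge]`, `hVt`, `hEt`; `[Nonempty 𝒢.graph.Edge]` (the one-vertex
edgeless `𝒢` is the disjoint case of abc-iut-w4-d071's ArithThm54 edgeless file); base vertices `v₀`/`w₀`; the Thm 3.7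
hypotheses `h37` and `hG`.  GONE relative to p447144 (v7): `hV`, `hbot`, `Rc`, `hRcV`, `hRcB`.  Nothing beyond the two
derivations, the instantiation and composition is proved here; typed ≠ proved for the residual inputs; this is Thm 5.4 for OUR tower decomposition; no
side taken on [IUTchIII] Cor. 3.12.
-/

namespace Literature.AnabelianGeometry.SemiGraphs

open CategoryTheory CategoryTheory.PreGaloisCategory Topology Filter Literature.AnabelianGeometry.Anabelioids
open Literature.AnabelianGeometry.EtaleTheta
open Literature.AnabelianGeometry.AbsoluteAnabelian (IsTopologicallyFinitelyGenerated)
open scoped Pointwise FintypeCatDiscrete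

universe u

/-! ### §1: in a connected semi-graph with an edge every vertex carries a branch -/

/-- In a connected semi-graph with at least one edge, every vertex carries a branch: the first step of a walk in
the barycentric subdivision from the vertex `v` to (the midpoint of) an edge `e` is a branch–vertex incidence at `v`.
[cite: MochizukiSemiAnbd2006, §1, p. 11] -/
theorem SemiGraph.exists_abuts_eq_some_of_isConnected (G : SemiGraph.{u}) (hc : G.IsConnected)
    (e : G.Edge) (v : G.Vertex) : ∃ b : G.Branch, G.abuts b = some v := by
  obtain ⟨p⟩ := hc.connected.preconnected (Sum.inl v) (Sum.inr (Sum.inl e))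
  cases p with
  | cons hadj _ =>
    obtain ⟨-, h | h⟩ := (SimpleGraph.fromRel_adj _ _ _).mp hadj
    · cases h
    · cases h with
      | branch_vertex b _ hb => exact ⟨b, hb⟩

namespace ProfiniteSemiGraph

/-! ### Prop 3.6 (iv) at `ρ_𝔾(a)`: vertex transport from branch transport -/

section VertexTransport

variable {𝒢 : ProfiniteSemiGraph.{u}} (c : TemperedPiChart 𝒢)
  {PA : Type u} [Group PA] (ρ' : PA →* TopOut c.G) (baseAct : PA →* Aut 𝒢.graph)

/-- **Vertex transport from branch transport** ([SemiAnbd] Prop 3.6 (iv) at `ρ_𝔾(a)` / Def 5.1 (i)): the T54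
DESIGN binder `hV` at a vertex `v` CARRYING A BRANCH follows from the branch-transport binder `hBR` — a verticial
subgroup at `v` is the range of a verticial homomorphism `ψ` (Thm 3.7 (i)), `hBR` at any branch `b` abutting to `v`
gives a representative `Φ` of `ρ′ a` with `Φ(range ψ) = x′·(range φ′)·x′⁻¹` for a verticial `φ′` at `a·v`, and
conjugates of verticial subgroups are verticial (`conj_mem_verticialSubgroups`, Prop 3.2).
[cite: MochizukiSemiAnbd2006, Thm 3.7 (i), p. 40] -/
theorem hV_of_hBR
    (hBR : ∀ (a : PA) (b : 𝒢.graph.Branch) (v : 𝒢.graph.Vertex) (hb : 𝒢.graph.abuts b = some v)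
      (φ : 𝒢.Gv v →ₜ* c.G), IsVerticialHom c v φ →
      ∃ Φ : contMulAut c.G, TopOut.mk _ Φ = ρ' a ∧
        ∃ φ' : 𝒢.Gv ((baseAct a).hom.vertexMap v) →ₜ* c.G,
          IsVerticialHom c ((baseAct a).hom.vertexMap v) φ' ∧
          ∃ x' : c.G,
            Subgroup.map (Φ : MulAut c.G).toMonoidHom φ.toMonoidHom.range =
              Subgroup.map (MulAut.conj x').toMonoidHom φ'.toMonoidHom.range ∧
            Subgroup.map (Φ : MulAut c.G).toMonoidHom
                (Subgroup.map φ.toMonoidHom (𝒢.branchSubgroup b v hb)) =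
              Subgroup.map (MulAut.conj x').toMonoidHom
                (Subgroup.map φ'.toMonoidHom
                  (𝒢.branchSubgroup ((baseAct a).hom.branchMap b) ((baseAct a).hom.vertexMap v)
                    ((baseAct a).hom.abuts_branchMap b v hb))))
    (a : PA) (v : 𝒢.graph.Vertex) (hv : ∃ b : 𝒢.graph.Branch, 𝒢.graph.abuts b = some v)
    (H : Subgroup c.G) (hH : H ∈ verticialSubgroups c v) :
    ∃ φ : contMulAut c.G, TopOut.mk _ φ = ρ' a ∧
      H.map (φ : MulAut c.G).toMonoidHom ∈ verticialSubgroups c ((baseAct a).hom.vertexMap v) := by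
  obtain ⟨ψ, hψ, rfl⟩ := hH
  obtain ⟨b, hb⟩ := hv
  obtain ⟨Φ, hΦ, φ', hφ', x', hr, -⟩ := hBR a b v hb ψ hψ
  exact ⟨Φ, hΦ, hr ▸ conj_mem_verticialSubgroups c ⟨φ', hφ', rfl⟩ x'⟩

/-- **`hV` in full from `hBR`** for a CONNECTED `𝒢` WITH AN EDGE (every vertex then carries a branch,
`SemiGraph.exists_abuts_eq_some_of_isConnected`): the Prop 3.6 (iv) vertex-transport datum of the outer model in
exactly the shape the T54 assemblies consume. [cite: MochizukiSemiAnbd2006, Thm 3.7 (i), p. 40] -/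
theorem hV_of_hBR_of_isConnected (hcn : 𝒢.graph.IsConnected) [he : Nonempty 𝒢.graph.Edge]
    (hBR : ∀ (a : PA) (b : 𝒢.graph.Branch) (v : 𝒢.graph.Vertex) (hb : 𝒢.graph.abuts b = some v)
      (φ : 𝒢.Gv v →ₜ* c.G), IsVerticialHom c v φ →
      ∃ Φ : contMulAut c.G, TopOut.mk _ Φ = ρ' a ∧
        ∃ φ' : 𝒢.Gv ((baseAct a).hom.vertexMap v) →ₜ* c.G,
          IsVerticialHom c ((baseAct a).hom.vertexMap v) φ' ∧
          ∃ x' : c.G,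
            Subgroup.map (Φ : MulAut c.G).toMonoidHom φ.toMonoidHom.range =
              Subgroup.map (MulAut.conj x').toMonoidHom φ'.toMonoidHom.range ∧
            Subgroup.map (Φ : MulAut c.G).toMonoidHom
                (Subgroup.map φ.toMonoidHom (𝒢.branchSubgroup b v hb)) =
              Subgroup.map (MulAut.conj x').toMonoidHom
                (Subgroup.map φ'.toMonoidHom
                  (𝒢.branchSubgroup ((baseAct a).hom.branchMap b) ((baseAct a).hom.vertexMap v)
                    ((baseAct a).hom.abuts_branchMap b v hb))))
    (a : PA) (v : 𝒢.graph.Vertex) (H : Subgroup c.G) (hH : H ∈ verticialSubgroups c v) :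
    ∃ φ : contMulAut c.G, TopOut.mk _ φ = ρ' a ∧
      H.map (φ : MulAut c.G).toMonoidHom ∈ verticialSubgroups c ((baseAct a).hom.vertexMap v) :=
  hV_of_hBR c ρ' baseAct hBR a v (𝒢.graph.exists_abuts_eq_some_of_isConnected hcn he.some v) H hH

end VertexTransport

/-! ### The vertex groups of the presentation of a cofinal Galois tower are verticial for its chart -/

namespace GaloisLevelData

variable {𝒢 : ProfiniteSemiGraph.{u}} (D : GaloisLevelData 𝒢) (h𝒢 : 𝒢.IsCountable)
  (hcof : ∀ (T : CovObj 𝒢), T.IsTempered → ∀ p : T.Point,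
    ∃ i : ℕ, ∀ j, i ≤ j → (D.S j).Splits (T.component p))
  (hcn : 𝒢.graph.IsConnected) (hS : ∀ n, (D.S n).Splits (D.S n)) (hfin : ∀ n, (D.S n).IsFinite)
  (hne : ∀ n, (D.S n).HasNonemptyFibres)
  (T : ∀ w : 𝒢.graph.Vertex, D.PointSeq h𝒢 w) (R : SemiGraph.RefBranches 𝒢.graph)

/-- The vertex groups `H_w = range (T w).decompHom` of abc-iut-L3-d4's presentation of `π₁^temp(𝒢)` read off the
cofinal Galois tower `D` are VERTICIAL for the chart of the tower (abc-iut-L3-t9's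
`range_decompHom_mem_verticialSubgroups_chart` under the `rfl` lemma `piPresentation_H`) — the `hPH` input of
abc-iut-w4-d059's `ChartRepresentatives.ofPresentation`. [cite: MochizukiSemiAnbd2006, Thm 3.7 (i), p. 40] -/
theorem piPresentation_H_mem_verticialSubgroups_chart (w : 𝒢.graph.Vertex) :
    (D.piPresentation h𝒢 T R).H w ∈ verticialSubgroups (D.chart h𝒢 hcof hcn hS hfin hne) w :=
  (T w).range_decompHom_mem_verticialSubgroups_chart hcof hcn hS hfin hne

end GaloisLevelData

/-! ### The chart of a cofinal Galois tower with characteristic levels -/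

variable {𝒢 : ProfiniteSemiGraph.{u}}

section Chart

variable (D : GaloisLevelData 𝒢)
  (hcof : ∀ (T : CovObj 𝒢), T.IsTempered → ∀ p : T.Point,
    ∃ i : ℕ, ∀ j, i ≤ j → (D.S j).Splits (T.component p))
  (hcn : 𝒢.graph.IsConnected) (hS : ∀ n, (D.S n).Splits (D.S n)) (hfin : ∀ n, (D.S n).IsFinite)
  (hne : ∀ n, (D.S n).HasNonemptyFibres)
  (hconn : ∀ (n : ℕ) (p q : (D.S n).Point), (D.S n).SameComponent p q)

/-- **[SemiAnbd] Thm 5.4 (i) ∧ (ii) at `π₁^temp(𝒢) ⋊^out Π_A` for the chart of a cofinal Galois tower with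
characteristic levels, level topology pinned — the DESIGN data REDUCED to branch transport `hBR` and
congruence-continuity `hCC`**: this seat's v7 `…_chart_of_designData_anyRc` (p447144) with the Prop 3.6 (iv) VERTEX
transport `hV` DERIVED from `hBR` (`hV_of_hBR_of_isConnected`: `𝒢` is connected with an edge, so every vertex carries a
branch; a verticial subgroup is the range of a verticial `ψ`, which `hBR` carries to a conjugate of the range of a
verticial `φ′` at `a·v`) and Thm 5.4's `hbot` DERIVED from `[Infinite Π_A]` (abc-iut-w4-d098's
`not_isArithAmple_bot_of_compactSpace`), and the pin `Rc`/`hRcV`/`hRcB` INSTANTIATED at abc-iut-w4-d059's term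
`ChartRepresentatives.ofPresentation` (p448734; `hRcV`/`hRcB` by `rfl`), so that Thm 5.4's `hest` is read at print's
own decomposition data and the conclusion holds at an arbitrary `Rc'`.  Residual: `hBR`, `hker`, `hfaithV`,
`n₁`/`hCC`, `hinst`, `noSwitchBase`, `hest`; frame `[Nonempty 𝒢.graph.Edge]`, `[Infinite Π_A]`.
[cite: MochizukiSemiAnbd2006, Thm 5.4 (i), p. 66] -/
theorem arithMaximalCompactStatement_outerAction_piPresentation_chart_of_branchTransport
    (h37 : 𝒢.Thm37Hypotheses) (hG : 𝒢.graph.IsGraph) [Finite 𝒢.graph.Vertex] [Finite 𝒢.graph.Branch]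
    [Finite 𝒢.graph.Edge]
    -- NEW in v8: `𝒢` has an edge (with `hcn`: every vertex carries a branch, so `hV` follows from `hBR`; the
    -- one-vertex EDGELESS case is abc-iut-w4-d071's separate file) and `Π_A` is infinite (⇒ `hbot`, abc-iut-w4-d098)
    [Nonempty 𝒢.graph.Edge]
    {PA : Type u} [Group PA] [TopologicalSpace PA] [IsTopologicalGroup PA] [CompactSpace PA]
    [TotallyDisconnectedSpace PA] [Infinite PA]
    (ρ' : PA →* TopOut (D.chart h37.toProp36Hypotheses.isCountable hcof hcn hS hfin hne).G) (baseAct : PA →* Aut 𝒢.graph)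
    [inst : TopologicalSpace (outerSemidirectProduct ρ')]
    (T : ∀ w : 𝒢.graph.Vertex, D.PointSeq h37.toProp36Hypotheses.isCountable w) (R : SemiGraph.RefBranches 𝒢.graph)
    -- NO pin binders `Rc`/`hRcV`/`hRcB` (v8): `hest` is read at the representatives READ OFF the presentation,
    -- abc-iut-w4-d059's TERM `ChartRepresentatives.ofPresentation` (p448734) — print's own decomposition data (p. 65);
    -- the CONCLUSION is stated for an ARBITRARY compatible choice `Rc'` of §3 representatives
    (Rc' : ChartRepresentatives (D.chart h37.toProp36Hypotheses.isCountable hcof hcn hS hfin hne))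
    -- Prop 3.6 (iv) at `ρ_𝔾(a)` / Def 5.1 (i): the DESIGN datum of the outer model is NOW ONLY the branch transport
    -- `hBR` (abc-iut-w4-d082's currency); vertex transport `hV`, edge transport `hE` and `hopen` are DERIVED
    (hBR : ∀ (a : PA) (b : 𝒢.graph.Branch) (v : 𝒢.graph.Vertex) (hb : 𝒢.graph.abuts b = some v)
      (φ : 𝒢.Gv v →ₜ* (D.chart h37.toProp36Hypotheses.isCountable hcof hcn hS hfin hne).G), IsVerticialHom (D.chart h37.toProp36Hypotheses.isCountable hcof hcn hS hfin hne) v φ →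
      ∃ Φ : contMulAut (D.chart h37.toProp36Hypotheses.isCountable hcof hcn hS hfin hne).G, TopOut.mk _ Φ = ρ' a ∧
        ∃ φ' : 𝒢.Gv ((baseAct a).hom.vertexMap v) →ₜ* (D.chart h37.toProp36Hypotheses.isCountable hcof hcn hS hfin hne).G,
          IsVerticialHom (D.chart h37.toProp36Hypotheses.isCountable hcof hcn hS hfin hne) ((baseAct a).hom.vertexMap v) φ' ∧
          ∃ x' : (D.chart h37.toProp36Hypotheses.isCountable hcof hcn hS hfin hne).G,
            Subgroup.map (Φ : MulAut (D.chart h37.toProp36Hypotheses.isCountable hcof hcn hS hfin hne).G).toMonoidHom φ.toMonoidHom.range =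
              Subgroup.map (MulAut.conj x').toMonoidHom φ'.toMonoidHom.range ∧
            Subgroup.map (Φ : MulAut (D.chart h37.toProp36Hypotheses.isCountable hcof hcn hS hfin hne).G).toMonoidHom
                (Subgroup.map φ.toMonoidHom (𝒢.branchSubgroup b v hb)) =
              Subgroup.map (MulAut.conj x').toMonoidHom
                (Subgroup.map φ'.toMonoidHom
                  (𝒢.branchSubgroup ((baseAct a).hom.branchMap b) ((baseAct a).hom.vertexMap v)
                    ((baseAct a).hom.abuts_branchMap b v hb))))
    (w₀ : 𝒢.graph.Vertex)
    -- CHARACTERISTIC finite levels (abc-iut-L3-t9 E1): `ker π_n` is the characteristic open core of level `d n`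
    (d : ℕ → ℕ) (hker : ∀ n, (D.piLevelAut h37.toProp36Hypotheses.isCountable hconn n).ker = charOpenCore (D.temperedPi h37.toProp36Hypotheses.isCountable) (d n))
    -- (I0v) for the tower `D` (abc-iut-w4-d053)
    (hfaithV : ∀ (v : 𝒢.graph.Vertex) (h : 𝒢.Gv v),
      (∀ (n : ℕ) (x : ((D.S n).SV v).obj.V), ((D.S n).SV v).obj.ρ h x = x) → h = 1)
    -- congruence-continuity of the outer action beyond depth `n₁` with trivial base action near `1` (`hCC`,
    -- Def 5.1 (i)(c)/(d) — DESIGN; `hK1′` and `hopen` are derived from it, abc-iut-w6-d117 p442489 / v6)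
    (n₁ : ℕ)
    (hCC : ∀ n, n₁ ≤ n → ∃ U ∈ 𝓝 (1 : PA), ∀ a ∈ U, baseAct a = 1 ∧
      ∃ φ : contMulAut (D.chart h37.toProp36Hypotheses.isCountable hcof hcn hS hfin hne).G, TopOut.mk (D.chart h37.toProp36Hypotheses.isCountable hcof hcn hS hfin hne).G φ = ρ' a ∧
        ∀ y : (D.chart h37.toProp36Hypotheses.isCountable hcof hcn hS hfin hne).G, (φ : MulAut (D.chart h37.toProp36Hypotheses.isCountable hcof hcn hS hfin hne).G) y * y⁻¹ ∈
          (D.projAut h37.toProp36Hypotheses.isCountable n).ker)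
    -- the topology of `E` IS abc-iut-w6-d070's tempered level topology at the chart of the tower, built over the
    -- DERIVED vertex transport `hV_of_hBR_of_isConnected … hBR` (`rfl` at consumers who let the instance be this term)
    (hinst : inst = @arithLevelTopology 𝒢 (D.chart h37.toProp36Hypotheses.isCountable hcof hcn hS hfin hne) PA _ _ _ ρ' baseAct
        (TemperedPiChart.firstCountableTopology_G (D.chart h37.toProp36Hypotheses.isCountable hcof hcn hS hfin hne)) h37.toProp36Hypotheses IsTempered.of_profinite (D.piPresentation h37.toProp36Hypotheses.isCountable T R)
        (isArithCompatible_piPresentation_outerAction_of_branchPair_chart_of_finite D h37.toProp36Hypotheses.isCountable hcof hcn hS hfin hne T R ρ' baseAct h37 hG (hV_of_hBR_of_isConnected (D.chart h37.toProp36Hypotheses.isCountable hcof hcn hS hfin hne) ρ' baseAct hcn hBR) hBR) w₀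
        (D.isCompact_piPresentation_H h37.toProp36Hypotheses.isCountable T R w₀) (fun n => (D.projAut h37.toProp36Hypotheses.isCountable n).ker) (fun _ => MonoidHom.normal_ker _)
        (D.hKst_and_hLst_of_ker_piLevelAut_eq_charOpenCore h37.toProp36Hypotheses.isCountable hconn T R ρ' (isArithCompatible_piPresentation_outerAction_of_branchPair_chart_of_finite D h37.toProp36Hypotheses.isCountable hcof hcn hS hfin hne T R ρ' baseAct h37 hG (hV_of_hBR_of_isConnected (D.chart h37.toProp36Hypotheses.isCountable hcof hcn hS hfin hne) ρ' baseAct hcn hBR) hBR) d hker).1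
        (D.ker_projAut_anti h37.toProp36Hypotheses.isCountable) (D.isOpen_ker_projAut h37.toProp36Hypotheses.isCountable) (fun _ hU => D.exists_ker_projAut_subset h37.toProp36Hypotheses.isCountable hU) (D.hK1'_chart_of_eventually_congruenceContinuous h37 hcof hcn hS hfin hne T R hconn ρ' baseAct (isArithCompatible_piPresentation_outerAction_of_branchPair_chart_of_finite D h37.toProp36Hypotheses.isCountable hcof hcn hS hfin hne T R ρ' baseAct h37 hG (hV_of_hBR_of_isConnected (D.chart h37.toProp36Hypotheses.isCountable hcof hcn hS hfin hne) ρ' baseAct hcn hBR) hBR) d hker hG n₁ hCC))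
    (noSwitchBase : NoBranchSwitching 𝒢.graph.edgeOf
      (fun (a : PA) (b : 𝒢.graph.Branch) => (baseAct a).hom.branchMap b))
    -- Thm 5.4's OWN hypothesis: total arithmetic estrangement (Def 5.3 (ii)) of print's decomposition data, i.e. at the
    -- representatives read off the presentation (NOT `Rc`-invariant at loops — abc-iut-w4-d089 p446672)
    (hest : IsTotallyArithEstranged (decompositionDataOfChart (ChartRepresentatives.ofPresentation (D.chart h37.toProp36Hypotheses.isCountable hcof hcn hS hfin hne) (D.piPresentation h37.toProp36Hypotheses.isCountable T R) (D.piPresentation_H_mem_verticialSubgroups_chart h37.toProp36Hypotheses.isCountable hcof hcn hS hfin hne T R) (piPresentation_M_mem_edgeLikeSubgroups_chart D h37.toProp36Hypotheses.isCountable hcof hcn hS hfin hne T R)) (toOuterSemidirectProduct ρ')) (outerSemidirectProductSnd ρ')) :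
    ArithMaximalCompactStatementI (decompositionDataOfChart Rc' (toOuterSemidirectProduct ρ')) (outerSemidirectProductSnd ρ') ∧
      ArithMaximalCompactStatementII (decompositionDataOfChart Rc' (toOuterSemidirectProduct ρ')) (outerSemidirectProductSnd ρ') :=
  arithMaximalCompactStatement_outerAction_piPresentation_chart_of_designData_anyRc D hcof hcn hS hfin hne
    hconn h37 hG ρ' baseAct T R
    -- the pin as a TERM (abc-iut-w4-d059 p448734): `Rc := ofPresentation …`, `hRcV`/`hRcB` by `rfl`
    (ChartRepresentatives.ofPresentation (D.chart h37.toProp36Hypotheses.isCountable hcof hcn hS hfin hne) (D.piPresentation h37.toProp36Hypotheses.isCountable T R) (D.piPresentation_H_mem_verticialSubgroups_chart h37.toProp36Hypotheses.isCountable hcof hcn hS hfin hne T R) (piPresentation_M_mem_edgeLikeSubgroups_chart D h37.toProp36Hypotheses.isCountable hcof hcn hS hfin hne T R)) (fun _ => rfl) (fun _ => rfl) Rc'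
    -- `hV` DERIVED from `hBR` (every vertex of the connected `𝒢` carries a branch since `𝒢` has an edge)
    (hV_of_hBR_of_isConnected (D.chart h37.toProp36Hypotheses.isCountable hcof hcn hS hfin hne) ρ' baseAct hcn hBR) hBR w₀ d hker hfaithV n₁ hCC hinst noSwitchBase hest
    -- `hbot` DERIVED: `Π_A` compact and infinite is not discrete (abc-iut-w4-d098)
    (not_isArithAmple_bot_of_compactSpace _)

end Chart

/-! ### The characteristic tower: CAPSTONE v8 -/

/-- **[SemiAnbd] Thm 5.4 (i) ∧ (ii) at `π₁^temp(𝒢) ⋊^out Π_A` for the chart of the CHARACTERISTIC Galois tower —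
CAPSTONE v8**: v7 (`…_charCores_of_designData_anyRc` p447144) with the design input `hV` (vertex transport, Prop 3.6 (iv)
at `ρ_𝔾(a)`) DERIVED from the branch transport `hBR` for a connected `𝒢` WITH AN EDGE (every vertex then carries a
branch — `SemiGraph.exists_abuts_eq_some_of_isConnected`; the one-vertex edgeless case is abc-iut-w4-d071's separate
file), Thm 5.4's own hypothesis `hbot` DERIVED from `[Infinite Π_A]` (abc-iut-w4-d098), and the pin `Rc`/`hRcV`/`hRcB`
INSTANTIATED at abc-iut-w4-d059's term `ChartRepresentatives.ofPresentation` (p448734): `hest` is read at print's own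
decomposition data (the representatives read off the presentation; `hest` is not `Rc`-invariant, abc-iut-w4-d089
p446672) and the conclusion holds at an arbitrary `Rc'`.  HONEST RESIDUAL (explicit binders): branch transport `hBR`
(DESIGN, abc-iut-w4-d082's currency), `n₁`/`hCC` (Def 5.1 (i)(c)/(d) congruence-continuity — DESIGN), `hinst` (`rfl`
at consumers), Thm 5.4's printed frame `noSwitchBase` and OWN hypothesis `hest`, `Rc'`, the §5 frame `[CompactSpace Π_A] [TotallyDisconnectedSpace Π_A] [Infinite Π_A]`, Def 5.1 (i)
coherence (`Finite` vertices/branches/edges, `hVt`, `hEt`), `[Nonempty 𝒢.graph.Edge]`, `v₀`/`w₀`, `h37`, `hG`.  GONE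
relative to v7: `hV`, `hbot`, `Rc`, `hRcV`, `hRcB`.  Nothing beyond the derivations, the instantiation and composition
is proved here; typed ≠ proved for
the residual inputs; this is Thm 5.4 for OUR tower decomposition; no side taken on [IUTchIII] Cor. 3.12.
[cite: MochizukiSemiAnbd2006, Thm 5.4 (i), p. 66] -/
theorem arithMaximalCompactStatement_outerAction_piPresentation_charCores_of_branchTransport
    (h37 : 𝒢.Thm37Hypotheses) (hG : 𝒢.graph.IsGraph) [Finite 𝒢.graph.Vertex] [Finite 𝒢.graph.Branch]
    [Finite 𝒢.graph.Edge]
    -- NEW in v8: `𝒢` has an edge (with `hcn`: every vertex carries a branch, so `hV` follows from `hBR`; the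
    -- one-vertex EDGELESS case is abc-iut-w4-d071's separate file) and `Π_A` is infinite (⇒ `hbot`, abc-iut-w4-d098)
    [Nonempty 𝒢.graph.Edge]
    (v₀ : 𝒢.graph.Vertex)
    -- coherence (Def 5.1 (i)): topologically finitely generated constituents — the input of the characteristic tower
    (hVt : ∀ v : 𝒢.graph.Vertex, IsTopologicallyFinitelyGenerated (𝒢.Gv v))
    (hEt : ∀ e : 𝒢.graph.Edge, IsTopologicallyFinitelyGenerated (𝒢.Ge e))
    {PA : Type u} [Group PA] [TopologicalSpace PA] [IsTopologicalGroup PA] [CompactSpace PA]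
    [TotallyDisconnectedSpace PA] [Infinite PA]
    (ρ' : PA →* TopOut ((GaloisLevelData.ofCharCores h37.toProp36Hypotheses v₀ hVt hEt).chart h37.toProp36Hypotheses.isCountable (ofCharCores_exists_level_splits_component h37.toProp36Hypotheses v₀ hVt hEt) h37.toProp36Hypotheses.isConnected (ofCharCores_splits_self h37.toProp36Hypotheses v₀ hVt hEt) (ofCharCores_isFinite h37.toProp36Hypotheses v₀ hVt hEt) (ofCharCores_hasNonemptyFibres h37.toProp36Hypotheses v₀ hVt hEt)).G) (baseAct : PA →* Aut 𝒢.graph)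
    [inst : TopologicalSpace (outerSemidirectProduct ρ')]
    (T : ∀ w : 𝒢.graph.Vertex, (GaloisLevelData.ofCharCores h37.toProp36Hypotheses v₀ hVt hEt).PointSeq h37.toProp36Hypotheses.isCountable w) (R : SemiGraph.RefBranches 𝒢.graph)
    -- NO pin binders `Rc`/`hRcV`/`hRcB` (v8): `hest` is read at the representatives READ OFF the presentation,
    -- abc-iut-w4-d059's TERM `ChartRepresentatives.ofPresentation` (p448734) — print's own decomposition data (p. 65);
    -- the CONCLUSION is stated for an ARBITRARY compatible choice `Rc'` of §3 representatives
    (Rc' : ChartRepresentatives ((GaloisLevelData.ofCharCores h37.toProp36Hypotheses v₀ hVt hEt).chart h37.toProp36Hypotheses.isCountable (ofCharCores_exists_level_splits_component h37.toProp36Hypotheses v₀ hVt hEt) h37.toProp36Hypotheses.isConnected (ofCharCores_splits_self h37.toProp36Hypotheses v₀ hVt hEt) (ofCharCores_isFinite h37.toProp36Hypotheses v₀ hVt hEt) (ofCharCores_hasNonemptyFibres h37.toProp36Hypotheses v₀ hVt hEt)))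
    -- Prop 3.6 (iv) at `ρ_𝔾(a)` / Def 5.1 (i): the DESIGN datum of the outer model is NOW ONLY the branch transport
    -- `hBR` (abc-iut-w4-d082's currency); vertex transport `hV`, edge transport `hE` and `hopen` are DERIVED
    (hBR : ∀ (a : PA) (b : 𝒢.graph.Branch) (v : 𝒢.graph.Vertex) (hb : 𝒢.graph.abuts b = some v)
      (φ : 𝒢.Gv v →ₜ* ((GaloisLevelData.ofCharCores h37.toProp36Hypotheses v₀ hVt hEt).chart h37.toProp36Hypotheses.isCountable (ofCharCores_exists_level_splits_component h37.toProp36Hypotheses v₀ hVt hEt) h37.toProp36Hypotheses.isConnected (ofCharCores_splits_self h37.toProp36Hypotheses v₀ hVt hEt) (ofCharCores_isFinite h37.toProp36Hypotheses v₀ hVt hEt) (ofCharCores_hasNonemptyFibres h37.toProp36Hypotheses v₀ hVt hEt)).G), IsVerticialHom ((GaloisLevelData.ofCharCores h37.toProp36Hypotheses v₀ hVt hEt).chart h37.toProp36Hypotheses.isCountable (ofCharCores_exists_level_splits_component h37.toProp36Hypotheses v₀ hVt hEt) h37.toProp36Hypotheses.isConnected (ofCharCores_splits_self h37.toProp36Hypotheses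 v₀ hVt hEt) (ofCharCores_isFinite h37.toProp36Hypotheses v₀ hVt hEt) (ofCharCores_hasNonemptyFibres h37.toProp36Hypotheses v₀ hVt hEt)) v φ →
      ∃ Φ : contMulAut ((GaloisLevelData.ofCharCores h37.toProp36Hypotheses v₀ hVt hEt).chart h37.toProp36Hypotheses.isCountable (ofCharCores_exists_level_splits_component h37.toProp36Hypotheses v₀ hVt hEt) h37.toProp36Hypotheses.isConnected (ofCharCores_splits_self h37.toProp36Hypotheses v₀ hVt hEt) (ofCharCores_isFinite h37.toProp36Hypotheses v₀ hVt hEt) (ofCharCores_hasNonemptyFibres h37.toProp36Hypotheses v₀ hVt hEt)).G, TopOut.mk _ Φ = ρ' a ∧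
        ∃ φ' : 𝒢.Gv ((baseAct a).hom.vertexMap v) →ₜ* ((GaloisLevelData.ofCharCores h37.toProp36Hypotheses v₀ hVt hEt).chart h37.toProp36Hypotheses.isCountable (ofCharCores_exists_level_splits_component h37.toProp36Hypotheses v₀ hVt hEt) h37.toProp36Hypotheses.isConnected (ofCharCores_splits_self h37.toProp36Hypotheses v₀ hVt hEt) (ofCharCores_isFinite h37.toProp36Hypotheses v₀ hVt hEt) (ofCharCores_hasNonemptyFibres h37.toProp36Hypotheses v₀ hVt hEt)).G,
          IsVerticialHom ((GaloisLevelData.ofCharCores h37.toProp36Hypotheses v₀ hVt hEt).chart h37.toProp36Hypotheses.isCountable (ofCharCores_exists_level_splits_component h37.toProp36Hypotheses v₀ hVt hEt) h37.toProp36Hypotheses.isConnected (ofCharCores_splits_self h37.toProp36Hypotheses v₀ hVt hEt) (ofCharCores_isFinite h37.toProp36Hypotheses v₀ hVt hEt) (ofCharCores_hasNonemptyFibres h37.toProp36Hypotheses v₀ hVt hEt)) ((baseAct a).hom.vertexMap v) φ' ∧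
          ∃ x' : ((GaloisLevelData.ofCharCores h37.toProp36Hypotheses v₀ hVt hEt).chart h37.toProp36Hypotheses.isCountable (ofCharCores_exists_level_splits_component h37.toProp36Hypotheses v₀ hVt hEt) h37.toProp36Hypotheses.isConnected (ofCharCores_splits_self h37.toProp36Hypotheses v₀ hVt hEt) (ofCharCores_isFinite h37.toProp36Hypotheses v₀ hVt hEt) (ofCharCores_hasNonemptyFibres h37.toProp36Hypotheses v₀ hVt hEt)).G,
            Subgroup.map (Φ : MulAut ((GaloisLevelData.ofCharCores h37.toProp36Hypotheses v₀ hVt hEt).chart h37.toProp36Hypotheses.isCountable (ofCharCores_exists_level_splits_component h37.toProp36Hypotheses v₀ hVt hEt) h37.toProp36Hypotheses.isConnected (ofCharCores_splits_self h37.toProp36Hypotheses v₀ hVt hEt) (ofCharCores_isFinite h37.toProp36Hypotheses v₀ hVt hEt) (ofCharCores_hasNonemptyFibres h37.toProp36Hypotheses v₀ hVt hEt)).G).toMonoidHom φ.toMonoidHom.range =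
              Subgroup.map (MulAut.conj x').toMonoidHom φ'.toMonoidHom.range ∧
            Subgroup.map (Φ : MulAut ((GaloisLevelData.ofCharCores h37.toProp36Hypotheses v₀ hVt hEt).chart h37.toProp36Hypotheses.isCountable (ofCharCores_exists_level_splits_component h37.toProp36Hypotheses v₀ hVt hEt) h37.toProp36Hypotheses.isConnected (ofCharCores_splits_self h37.toProp36Hypotheses v₀ hVt hEt) (ofCharCores_isFinite h37.toProp36Hypotheses v₀ hVt hEt) (ofCharCores_hasNonemptyFibres h37.toProp36Hypotheses v₀ hVt hEt)).G).toMonoidHom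
                (Subgroup.map φ.toMonoidHom (𝒢.branchSubgroup b v hb)) =
              Subgroup.map (MulAut.conj x').toMonoidHom
                (Subgroup.map φ'.toMonoidHom
                  (𝒢.branchSubgroup ((baseAct a).hom.branchMap b) ((baseAct a).hom.vertexMap v)
                    ((baseAct a).hom.abuts_branchMap b v hb))))
    (w₀ : 𝒢.graph.Vertex)
    -- congruence-continuity of the outer action beyond depth `n₁` with trivial base action near `1` (`hCC`,
    -- Def 5.1 (i)(c)/(d) — DESIGN; `hK1′` and `hopen` are derived from it, abc-iut-w6-d117 p442489 / v6)
    (n₁ : ℕ)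
    (hCC : ∀ n, n₁ ≤ n → ∃ U ∈ 𝓝 (1 : PA), ∀ a ∈ U, baseAct a = 1 ∧
      ∃ φ : contMulAut ((GaloisLevelData.ofCharCores h37.toProp36Hypotheses v₀ hVt hEt).chart h37.toProp36Hypotheses.isCountable (ofCharCores_exists_level_splits_component h37.toProp36Hypotheses v₀ hVt hEt) h37.toProp36Hypotheses.isConnected (ofCharCores_splits_self h37.toProp36Hypotheses v₀ hVt hEt) (ofCharCores_isFinite h37.toProp36Hypotheses v₀ hVt hEt) (ofCharCores_hasNonemptyFibres h37.toProp36Hypotheses v₀ hVt hEt)).G, TopOut.mk ((GaloisLevelData.ofCharCores h37.toProp36Hypotheses v₀ hVt hEt).chart h37.toProp36Hypotheses.isCountable (ofCharCores_exists_level_splits_component h37.toProp36Hypotheses v₀ hVt hEt) h37.toProp36Hypotheses.isConnected (ofCharCores_splits_self h37.toProp36Hypotheses v₀ hVt hEt) (ofCharCores_isFinite h37.toProp36Hypotheses v₀ hVt hEt) (ofCharCores_hasNonemptyFibres h37.toProp36Hypotheses v₀ hVt hEt)).G φ = ρ' a ∧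
        ∀ y : ((GaloisLevelData.ofCharCores h37.toProp36Hypotheses v₀ hVt hEt).chart h37.toProp36Hypotheses.isCountable (ofCharCores_exists_level_splits_component h37.toProp36Hypotheses v₀ hVt hEt) h37.toProp36Hypotheses.isConnected (ofCharCores_splits_self h37.toProp36Hypotheses v₀ hVt hEt) (ofCharCores_isFinite h37.toProp36Hypotheses v₀ hVt hEt) (ofCharCores_hasNonemptyFibres h37.toProp36Hypotheses v₀ hVt hEt)).G, (φ : MulAut ((GaloisLevelData.ofCharCores h37.toProp36Hypotheses v₀ hVt hEt).chart h37.toProp36Hypotheses.isCountable (ofCharCores_exists_level_splits_component h37.toProp36Hypotheses v₀ hVt hEt) h37.toProp36Hypotheses.isConnected (ofCharCores_splits_self h37.toProp36Hypotheses v₀ hVt hEt) (ofCharCores_isFinite h37.toProp36Hypotheses v₀ hVt hEt) (ofCharCores_hasNonemptyFibres h37.toProp36Hypotheses v₀ hVt hEt)).G) y * y⁻¹ ∈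
          ((GaloisLevelData.ofCharCores h37.toProp36Hypotheses v₀ hVt hEt).projAut h37.toProp36Hypotheses.isCountable n).ker)
    -- the topology of `E` IS abc-iut-w6-d070's tempered level topology at the chart of the tower, built over the
    -- DERIVED vertex transport `hV_of_hBR_of_isConnected … hBR` (`rfl` at consumers who let the instance be this term)
    (hinst : inst = @arithLevelTopology 𝒢 ((GaloisLevelData.ofCharCores h37.toProp36Hypotheses v₀ hVt hEt).chart h37.toProp36Hypotheses.isCountable (ofCharCores_exists_level_splits_component h37.toProp36Hypotheses v₀ hVt hEt) h37.toProp36Hypotheses.isConnected (ofCharCores_splits_self h37.toProp36Hypotheses v₀ hVt hEt) (ofCharCores_isFinite h37.toProp36Hypotheses v₀ hVt hEt) (ofCharCores_hasNonemptyFibres h37.toProp36Hypotheses v₀ hVt hEt)) PA _ _ _ ρ' baseAct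
        (TemperedPiChart.firstCountableTopology_G ((GaloisLevelData.ofCharCores h37.toProp36Hypotheses v₀ hVt hEt).chart h37.toProp36Hypotheses.isCountable (ofCharCores_exists_level_splits_component h37.toProp36Hypotheses v₀ hVt hEt) h37.toProp36Hypotheses.isConnected (ofCharCores_splits_self h37.toProp36Hypotheses v₀ hVt hEt) (ofCharCores_isFinite h37.toProp36Hypotheses v₀ hVt hEt) (ofCharCores_hasNonemptyFibres h37.toProp36Hypotheses v₀ hVt hEt))) h37.toProp36Hypotheses IsTempered.of_profinite ((GaloisLevelData.ofCharCores h37.toProp36Hypotheses v₀ hVt hEt).piPresentation h37.toProp36Hypotheses.isCountable T R)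
        (isArithCompatible_piPresentation_outerAction_of_branchPair_chart_of_finite (GaloisLevelData.ofCharCores h37.toProp36Hypotheses v₀ hVt hEt) h37.toProp36Hypotheses.isCountable (ofCharCores_exists_level_splits_component h37.toProp36Hypotheses v₀ hVt hEt) h37.toProp36Hypotheses.isConnected (ofCharCores_splits_self h37.toProp36Hypotheses v₀ hVt hEt) (ofCharCores_isFinite h37.toProp36Hypotheses v₀ hVt hEt) (ofCharCores_hasNonemptyFibres h37.toProp36Hypotheses v₀ hVt hEt) T R ρ' baseAct h37 hG (hV_of_hBR_of_isConnected ((GaloisLevelData.ofCharCores h37.toProp36Hypotheses v₀ hVt hEt).chart h37.toProp36Hypotheses.isCountable (ofCharCores_exists_level_splits_component h37.toProp36Hypotheses v₀ hVt hEt) h37.toProp36Hypotheses.isConnected (ofCharCores_splits_self h37.toProp36Hypotheses v₀ hVt hEt) (ofCharCores_isFinite h37.toProp36Hypotheses v₀ hVt hEt) (ofCharCores_hasNonemptyFibres h37.toProp36Hypotheses v₀ hVt hEt)) ρ' baseAct h37.toProp36Hypotheses.isConnected hBR) hBR) w₀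
        ((GaloisLevelData.ofCharCores h37.toProp36Hypotheses v₀ hVt hEt).isCompact_piPresentation_H h37.toProp36Hypotheses.isCountable T R w₀) (fun n => ((GaloisLevelData.ofCharCores h37.toProp36Hypotheses v₀ hVt hEt).projAut h37.toProp36Hypotheses.isCountable n).ker) (fun _ => MonoidHom.normal_ker _)
        ((GaloisLevelData.ofCharCores h37.toProp36Hypotheses v₀ hVt hEt).hKst_and_hLst_of_ker_piLevelAut_eq_charOpenCore h37.toProp36Hypotheses.isCountable (ofCharCores_sameComponent h37.toProp36Hypotheses v₀ hVt hEt) T R ρ' (isArithCompatible_piPresentation_outerAction_of_branchPair_chart_of_finite (GaloisLevelData.ofCharCores h37.toProp36Hypotheses v₀ hVt hEt) h37.toProp36Hypotheses.isCountable (ofCharCores_exists_level_splits_component h37.toProp36Hypotheses v₀ hVt hEt) h37.toProp36Hypotheses.isConnected (ofCharCores_splits_self h37.toProp36Hypotheses v₀ hVt hEt) (ofCharCores_isFinite h37.toProp36Hypotheses v₀ hVt hEt) (ofCharCores_hasNonemptyFibres h37.toProp36Hypotheses v₀ hVt hEt) T R ρ' baseAct h37 hG (hV_of_hBR_of_isConnected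 ((GaloisLevelData.ofCharCores h37.toProp36Hypotheses v₀ hVt hEt).chart h37.toProp36Hypotheses.isCountable (ofCharCores_exists_level_splits_component h37.toProp36Hypotheses v₀ hVt hEt) h37.toProp36Hypotheses.isConnected (ofCharCores_splits_self h37.toProp36Hypotheses v₀ hVt hEt) (ofCharCores_isFinite h37.toProp36Hypotheses v₀ hVt hEt) (ofCharCores_hasNonemptyFibres h37.toProp36Hypotheses v₀ hVt hEt)) ρ' baseAct h37.toProp36Hypotheses.isConnected hBR) hBR) (fun k : ℕ => k) (GaloisLevelData.ofCharCores_ker_piLevelAut_eq_charOpenCore h37.toProp36Hypotheses v₀ hVt hEt)).1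
        ((GaloisLevelData.ofCharCores h37.toProp36Hypotheses v₀ hVt hEt).ker_projAut_anti h37.toProp36Hypotheses.isCountable) ((GaloisLevelData.ofCharCores h37.toProp36Hypotheses v₀ hVt hEt).isOpen_ker_projAut h37.toProp36Hypotheses.isCountable) (fun _ hU => (GaloisLevelData.ofCharCores h37.toProp36Hypotheses v₀ hVt hEt).exists_ker_projAut_subset h37.toProp36Hypotheses.isCountable hU) ((GaloisLevelData.ofCharCores h37.toProp36Hypotheses v₀ hVt hEt).hK1'_chart_of_eventually_congruenceContinuous h37 (ofCharCores_exists_level_splits_component h37.toProp36Hypotheses v₀ hVt hEt) h37.toProp36Hypotheses.isConnected (ofCharCores_splits_self h37.toProp36Hypotheses v₀ hVt hEt) (ofCharCores_isFinite h37.toProp36Hypotheses v₀ hVt hEt) (ofCharCores_hasNonemptyFibres h37.toProp36Hypotheses v₀ hVt hEt) T R (ofCharCores_sameComponent h37.toProp36Hypotheses v₀ hVt hEt) ρ' baseAct (isArithCompatible_piPresentation_outerAction_of_branchPair_chart_of_finite (GaloisLevelData.ofCharCores h37.toProp36Hypotheses v₀ hVt hEt) h37.toProp36Hypotheses.isCountable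 (ofCharCores_exists_level_splits_component h37.toProp36Hypotheses v₀ hVt hEt) h37.toProp36Hypotheses.isConnected (ofCharCores_splits_self h37.toProp36Hypotheses v₀ hVt hEt) (ofCharCores_isFinite h37.toProp36Hypotheses v₀ hVt hEt) (ofCharCores_hasNonemptyFibres h37.toProp36Hypotheses v₀ hVt hEt) T R ρ' baseAct h37 hG (hV_of_hBR_of_isConnected ((GaloisLevelData.ofCharCores h37.toProp36Hypotheses v₀ hVt hEt).chart h37.toProp36Hypotheses.isCountable (ofCharCores_exists_level_splits_component h37.toProp36Hypotheses v₀ hVt hEt) h37.toProp36Hypotheses.isConnected (ofCharCores_splits_self h37.toProp36Hypotheses v₀ hVt hEt) (ofCharCores_isFinite h37.toProp36Hypotheses v₀ hVt hEt) (ofCharCores_hasNonemptyFibres h37.toProp36Hypotheses v₀ hVt hEt)) ρ' baseAct h37.toProp36Hypotheses.isConnected hBR) hBR) (fun k : ℕ => k) (GaloisLevelData.ofCharCores_ker_piLevelAut_eq_charOpenCore h37.toProp36Hypotheses v₀ hVt hEt) hG n₁ hCC))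
    (noSwitchBase : NoBranchSwitching 𝒢.graph.edgeOf
      (fun (a : PA) (b : 𝒢.graph.Branch) => (baseAct a).hom.branchMap b))
    -- Thm 5.4's OWN hypothesis: total arithmetic estrangement (Def 5.3 (ii)) of print's decomposition data, i.e. at the
    -- representatives read off the presentation (NOT `Rc`-invariant at loops — abc-iut-w4-d089 p446672)
    (hest : IsTotallyArithEstranged (decompositionDataOfChart (ChartRepresentatives.ofPresentation ((GaloisLevelData.ofCharCores h37.toProp36Hypotheses v₀ hVt hEt).chart h37.toProp36Hypotheses.isCountable (ofCharCores_exists_level_splits_component h37.toProp36Hypotheses v₀ hVt hEt) h37.toProp36Hypotheses.isConnected (ofCharCores_splits_self h37.toProp36Hypotheses v₀ hVt hEt) (ofCharCores_isFinite h37.toProp36Hypotheses v₀ hVt hEt) (ofCharCores_hasNonemptyFibres h37.toProp36Hypotheses v₀ hVt hEt)) ((GaloisLevelData.ofCharCores h37.toProp36Hypotheses v₀ hVt hEt).piPresentation h37.toProp36Hypotheses.isCountable T R) ((GaloisLevelData.ofCharCores h37.toProp36Hypotheses v₀ hVt hEt).piPresentation_H_mem_verticialSubgroups_chart h37.toProp36Hypotheses.isCountable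 (ofCharCores_exists_level_splits_component h37.toProp36Hypotheses v₀ hVt hEt) h37.toProp36Hypotheses.isConnected (ofCharCores_splits_self h37.toProp36Hypotheses v₀ hVt hEt) (ofCharCores_isFinite h37.toProp36Hypotheses v₀ hVt hEt) (ofCharCores_hasNonemptyFibres h37.toProp36Hypotheses v₀ hVt hEt) T R) (piPresentation_M_mem_edgeLikeSubgroups_chart (GaloisLevelData.ofCharCores h37.toProp36Hypotheses v₀ hVt hEt) h37.toProp36Hypotheses.isCountable (ofCharCores_exists_level_splits_component h37.toProp36Hypotheses v₀ hVt hEt) h37.toProp36Hypotheses.isConnected (ofCharCores_splits_self h37.toProp36Hypotheses v₀ hVt hEt) (ofCharCores_isFinite h37.toProp36Hypotheses v₀ hVt hEt) (ofCharCores_hasNonemptyFibres h37.toProp36Hypotheses v₀ hVt hEt) T R)) (toOuterSemidirectProduct ρ')) (outerSemidirectProductSnd ρ')) :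
    ArithMaximalCompactStatementI (decompositionDataOfChart Rc' (toOuterSemidirectProduct ρ')) (outerSemidirectProductSnd ρ') ∧
      ArithMaximalCompactStatementII (decompositionDataOfChart Rc' (toOuterSemidirectProduct ρ')) (outerSemidirectProductSnd ρ') :=
  arithMaximalCompactStatement_outerAction_piPresentation_chart_of_branchTransport (GaloisLevelData.ofCharCores h37.toProp36Hypotheses v₀ hVt hEt)
    (ofCharCores_exists_level_splits_component h37.toProp36Hypotheses v₀ hVt hEt) h37.toProp36Hypotheses.isConnected
    (ofCharCores_splits_self h37.toProp36Hypotheses v₀ hVt hEt) (ofCharCores_isFinite h37.toProp36Hypotheses v₀ hVt hEt) (ofCharCores_hasNonemptyFibres h37.toProp36Hypotheses v₀ hVt hEt)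
    (ofCharCores_sameComponent h37.toProp36Hypotheses v₀ hVt hEt) h37 hG ρ' baseAct T R Rc' hBR w₀ (fun k : ℕ => k) (GaloisLevelData.ofCharCores_ker_piLevelAut_eq_charOpenCore h37.toProp36Hypotheses v₀ hVt hEt)
    (faithfulV_ofCharCores v₀ h37 hVt hEt) n₁ hCC hinst noSwitchBase hest

end ProfiniteSemiGraph

end Literature.AnabelianGeometry.SemiGraphs
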